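import Literature.NumberTheory.Sieve.RosserSieveMainTerm
import HarnessLib

/-!
# Extending the sieving range by a finite set of primes: Nathanson's Lemma 9.1 and Theorem 9.2

Topic `Literature/NumberTheory/Sieve`; fifth file of the explicit form of the Jurkat–Richert
theorem following M. B. Nathanson, *Additive Number Theory: The Classical Bases*, GTM 164 (1996),
Ch. 9, §9.1 (PDF pp. 146–148 of the held copy) [Nathanson1996]. Everything here is PROVED.

**Lemma 9.1 / Theorem 9.2.** Given an upper bound sieve `λ₁⁺` with sieving range `𝒫₁` and support
level `D`, `|λ₁⁺| ≤ 1`, and a finite set of primes `𝒬` disjoint from `𝒫₁` with product `Q`, the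
function `λ⁺(d) = λ₁⁺(d₁) μ(d₂)` (`d = d₁ d₂`, `d₁` prime to `Q`, `d₂ ∣ Q`) is an upper bound sieve
with sieving range `𝒫 = 𝒫₁ ∪ 𝒬` and support level `DQ`, its main term factors as
`G(z, λ⁺) = G(z, λ₁⁺) ∏_{q ∈ 𝒬} (1 − g(q))`, and hence
`S(A, 𝒫, z) ≤ ∑_n a(n) G_n(z, λ₁⁺) ∏_{q ∈ 𝒬} (1 − g_n(q)) + R(DQ, 𝒫, z)`,
`R(DQ, 𝒫, z) = ∑_{d ∣ P(z), d < DQ} |r(d)|`.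

Here this is carried out for Rosser's upper weights `λ₁⁺ = μ χ⁺_D` with `β = 2`
(`BetaSieve.ind 1 2 D`, `SieveFrameworkFundamentalLemma.lean`) over an arbitrary squarefree `P₁`,
for a sifted sequence `A : SieveSequence` (weights `a(n) ≥ 0`, multiplicative density `g`, so
`g_n = g`) in the finite form of the tree (`A.sifted x P`, `A.congrSum`, `A.remainder`):

* `BetaSieve.compWeight D P₁ d = μ(d) χ⁺_D(gcd(d, P₁))` — Nathanson's `λ⁺(d) = λ₁⁺(d₁) μ(d₂)`
  (for squarefree `d`, `μ(d) = μ(d₁) μ(d₂)`);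
* `BetaSieve.compWeight_upper_sieve` — `[m = 1] ≤ ∑_{d ∣ m} λ⁺(d)` for squarefree `m ∣ P₁ Q`
  (Lemma 9.1, (9.4)–(9.5));
* `BetaSieve.sum_compWeight_mul_eq` — `∑_{d ∣ P₁Q} λ⁺(d) g(d) = G(λ₁⁺) ∏_{q ∣ Q} (1 − g(q))` with
  `G(λ₁⁺) = BetaSieve.mainSum 1 g 2 D P₁` (Lemma 9.1, last display);
* `BetaSieve.lt_of_compWeight_ne_zero` — support level `DQ` (Lemma 9.1);
* `SieveSequence.sifted_le_compositeSieve` — **Theorem 9.2 (upper bound)**: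
  `S(A, P₁Q; x) ≤ X · G(λ₁⁺) ∏_{q ∣ Q}(1 − g(q)) + ∑_{d ∣ P₁Q, d < DQ} |R_d(x)|`.

## References

* M. B. Nathanson, *Additive Number Theory: The Classical Bases*, GTM 164, Springer (1996), Ch. 9,
  Theorem 9.1, Lemma 9.1, Theorem 9.2. [Nathanson1996]
-/

open Finset
open scoped ArithmeticFunction.Moebius ArithmeticFunction.omega

noncomputable section

namespace Literature.NumberTheory.Sieve

namespace BetaSieve

variable {D : ℝ} {P₁ : ℕ}

/-! ### The composite weights `λ⁺(d) = μ(d) χ⁺_D(gcd(d, P₁))` -/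

/-- Nathanson's composite upper-bound sieve (Lemma 9.1, (9.7)) for Rosser's weights with `β = 2`:
`λ⁺(d) = μ(d) χ⁺_D(d₁)` where `d₁ = gcd(d, P₁)` is the part of `d` in the sieving range `𝒫₁` (the
prime factors of the squarefree `P₁`); on the exceptional primes (prime to `P₁`) it is the full
Möbius function. [cite: Nathanson1996, Lemma 9.1 (9.7)] -/
def compWeight (D : ℝ) (P₁ d : ℕ) : ℝ :=
  (μ d : ℝ) * ind 1 2 D (Nat.gcd d P₁)

/-- Unfolding lemma for `compWeight`. [folklore] -/
theorem compWeight_def (D : ℝ) (P₁ d : ℕ) : compWeight D P₁ d = (μ d : ℝ) * ind 1 2 D (Nat.gcd d P₁) := rfl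

/-- `|λ⁺(d)| ≤ 1`. [cite: Nathanson1996, Thm 9.2 (hypothesis |λ₁| ≤ 1)] -/
theorem abs_compWeight_le_one (D : ℝ) (P₁ d : ℕ) : |compWeight D P₁ d| ≤ 1 := by
  rw [compWeight, abs_mul]
  have h1 : |(μ d : ℝ)| ≤ 1 := by
    have := ArithmeticFunction.abs_moebius_le_one (n := d)
    exact_mod_cast this
  have h2 : |ind 1 2 D (Nat.gcd d P₁)| ≤ 1 := abs_ind_le_one _
  exact mul_le_one₀ h1 (abs_nonneg _) h2

/-- On the divisors of `P₁` the composite weight is Rosser's weight `μ(d) χ⁺(d)`. [folklore] -/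
theorem compWeight_of_dvd {d : ℕ} (hd : d ∣ P₁) : compWeight D P₁ d = (μ d : ℝ) * ind 1 2 D d := by
  rw [compWeight, Nat.gcd_eq_left hd]

/-- Multiplying by a prime `q` prime to `P₁` flips the sign: `λ⁺(dq) = −λ⁺(d)` (`q ∤ d`).
[cite: Nathanson1996, Lemma 9.1 (proof)] -/
theorem compWeight_mul_prime {d q : ℕ} (hq : q.Prime) (hqd : ¬ q ∣ d) (hqP : Nat.Coprime q P₁) :
    compWeight D P₁ (d * q) = -compWeight D P₁ d := by
  rw [compWeight, compWeight, moebius_mul_prime hq hqd, Nat.Coprime.gcd_mul_right_cancel d hqP]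
  ring

/-! ### Lemma 9.1: the upper-sieve property -/

/-- **Lemma 9.1, upper-sieve property**: for every squarefree `m`,
`[m = 1] ≤ ∑_{d ∣ m} μ(d) χ⁺_D(gcd(d, P₁))`. If every prime factor of `m` divides `P₁` this is the
upper-sieve inequality of Rosser's weights (`BetaSieve.upper_sieve`, `gcd(d, P₁) = d`); otherwise
some prime `q ∣ m` is prime to `P₁` and the sum vanishes (pair `d ↔ dq`: `λ⁺(dq) = −λ⁺(d)`), as in
Nathanson's proof (`∑_{d₂ ∣ m₂} μ(d₂) = 0` for `m₂ > 1`). [cite: Nathanson1996, Lemma 9.1] -/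
theorem compWeight_upper_sieve {m : ℕ} (hm : Squarefree m) :
    (if m = 1 then (1 : ℝ) else 0) ≤ ∑ d ∈ m.divisors, compWeight D P₁ d := by
  by_cases hall : ∀ q ∈ m.primeFactors, q ∣ P₁
  · -- `m ∣ P₁`-like case: all divisors `d` of `m` have `gcd(d, P₁) = d`
    have hdiv : ∀ d ∈ m.divisors, compWeight D P₁ d = (μ d : ℝ) * ind 1 2 D d := by
      intro d hd
      have hdm : d ∣ m := Nat.dvd_of_mem_divisors hd
      have hdsq : Squarefree d := hm.squarefree_of_dvd hdm
      refine compWeight_of_dvd ?_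
      rw [← Nat.prod_primeFactors_of_squarefree hdsq]
      refine Finset.prod_primes_dvd _ (fun p hp => (Nat.prime_of_mem_primeFactors hp).prime) ?_
      intro p hp
      exact hall p (Nat.primeFactors_mono hdm hm.ne_zero hp)
    rw [Finset.sum_congr rfl hdiv]
    exact upper_sieve hm
  · -- some prime `q ∣ m` with `q ∤ P₁`: the sum vanishes
    push Not at hall
    obtain ⟨q, hq, hqP⟩ := hall
    have hqp : q.Prime := Nat.prime_of_mem_primeFactors hq
    have hqm : q ∣ m := Nat.dvd_of_mem_primeFactors hq
    have hm1 : m ≠ 1 := fun h => by simp [h] at hq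
    rw [if_neg hm1]
    obtain ⟨m', rfl⟩ := hqm
    have hqm' : ¬ q ∣ m' := fun h => by
      have : q * q ∣ q * m' := Nat.mul_dvd_mul_left q h
      exact hqp.ne_one (Nat.isUnit_iff.mp (hm _ this))
    have hcop : Nat.Coprime q P₁ := (Nat.Prime.coprime_iff_not_dvd hqp).mpr hqP
    rw [mul_comm, sum_divisors_mul_prime hqp hqm']
    rw [Finset.sum_congr rfl fun d _ => compWeight_mul_prime (D := D) hqp ?_ hcop]
    · simp [Finset.sum_neg_distrib]
    · intro h
      exact hqm' (h.trans (Nat.dvd_of_mem_divisors ‹d ∈ m'.divisors›))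

/-! ### Lemma 9.1: the main term factors -/

/-- **Lemma 9.1, main term**: for multiplicative `g` and a finite set `Q` of primes not dividing
`P₁`,
`∑_{d ∣ P₁ ∏Q} μ(d) χ⁺_D(gcd(d, P₁)) g(d) = (∑_{d ∣ P₁} μ(d) χ⁺_D(d) g(d)) ∏_{q ∈ Q} (1 − g(q))`,
i.e. `G(z, λ⁺) = G(z, λ₁⁺) ∏_{q ∣ Q}(1 − g(q))` (induction on `Q`, peeling one prime at a time).
[cite: Nathanson1996, Lemma 9.1] -/
theorem sum_compWeight_mul_eq {g : ArithmeticFunction ℝ} (hg : g.IsMultiplicative)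
    (Q : Finset ℕ) (hQ : ∀ q ∈ Q, q.Prime ∧ ¬ q ∣ P₁) :
    ∑ d ∈ (P₁ * ∏ q ∈ Q, q).divisors, compWeight D P₁ d * g d =
      mainSum 1 g 2 D P₁ * ∏ q ∈ Q, (1 - g q) := by
  classical
  induction Q using Finset.induction_on with
  | empty =>
    rw [Finset.prod_empty, Finset.prod_empty, mul_one, mul_one, mainSum]
    refine Finset.sum_congr rfl fun d hd => ?_
    rw [compWeight_of_dvd (Nat.dvd_of_mem_divisors hd)]
  | insert q Q hqQ ih =>
    have hq := hQ q (Finset.mem_insert_self q Q)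
    have hQ' : ∀ r ∈ Q, r.Prime ∧ ¬ r ∣ P₁ := fun r hr => hQ r (Finset.mem_insert_of_mem hr)
    rw [Finset.prod_insert hqQ, Finset.prod_insert hqQ]
    -- `P₁ * (q * ∏ Q) = (P₁ * ∏ Q) * q` with `q ∤ P₁ * ∏ Q`
    set P := P₁ * ∏ r ∈ Q, r with hP
    have hqP : ¬ q ∣ P := by
      intro h
      rcases (Nat.Prime.dvd_mul hq.1).mp h with h1 | h2
      · exact hq.2 h1
      · obtain ⟨r, hr, hqr⟩ := (Prime.dvd_finsetProd_iff hq.1.prime _).mp h2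
        have hrp := (hQ' r hr).1
        have : q = r := (Nat.prime_dvd_prime_iff_eq hq.1 hrp).mp hqr
        exact hqQ (this ▸ hr)
    have hcop : Nat.Coprime q P₁ := (Nat.Prime.coprime_iff_not_dvd hq.1).mpr hq.2
    rw [show P₁ * (q * ∏ r ∈ Q, r) = P * q by rw [hP]; ring, sum_divisors_mul_prime hq.1 hqP, ih hQ']
    have hterm : ∀ d ∈ P.divisors, compWeight D P₁ (d * q) * g (d * q) =
        -(g q) * (compWeight D P₁ d * g d) := by
      intro d hd
      have hdP : d ∣ P := Nat.dvd_of_mem_divisors hd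
      have hqd : ¬ q ∣ d := fun h => hqP (h.trans hdP)
      have hcop' : Nat.Coprime d q := (Nat.coprime_comm.mp ((Nat.Prime.coprime_iff_not_dvd hq.1).mpr hqd))
      rw [compWeight_mul_prime hq.1 hqd hcop, hg.map_mul_of_coprime hcop']
      ring
    rw [Finset.sum_congr rfl hterm, ← Finset.mul_sum, ih hQ']
    ring

/-! ### Lemma 9.1: the support level `DQ` -/

/-- **Lemma 9.1, support level**: if `λ⁺(d) ≠ 0` for a squarefree `d ∣ P₁ Q` whose prime factors in
`P₁` are `< z ≤ D` (`D > 1`), then `d < D Q`: indeed `d = gcd(d, P₁) gcd(d, Q)` with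
`χ⁺_D(gcd(d, P₁)) = 1`, so `gcd(d, P₁) < D` (`BetaSieve.lt_level_of_pred_of_one_le`), and
`gcd(d, Q) ≤ Q`. [cite: Nathanson1996, Lemma 9.1] -/
theorem lt_of_compWeight_ne_zero {Qp : ℕ} (hcop : Nat.Coprime P₁ Qp) (hQp : 0 < Qp) {z : ℝ}
    (hD1 : 1 < D) (hzD : z ≤ D) (hP₁z : ∀ p ∈ P₁.primeFactors, (p : ℝ) < z) (hP₁ : Squarefree P₁)
    {d : ℕ} (hd : d ∣ P₁ * Qp) (hne : compWeight D P₁ d ≠ 0) : (d : ℝ) < D * Qp := by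
  set d₁ := Nat.gcd d P₁ with hd₁
  set d₂ := Nat.gcd d Qp with hd₂
  have hsplit : d = d₁ * d₂ := by
    have h := Nat.Coprime.gcd_mul d hcop
    rwa [Nat.gcd_eq_left hd] at h
  have hpred : pred 1 2 D d₁ := by
    by_contra h
    exact hne (by rw [compWeight, ind_of_not_pred h, mul_zero])
  have hd₁P : d₁ ∣ P₁ := Nat.gcd_dvd_right d P₁
  have hd₁sq : Squarefree d₁ := hP₁.squarefree_of_dvd hd₁P
  have hd₁z : ∀ p ∈ d₁.primeFactors, (p : ℝ) < z := fun p hp =>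
    hP₁z p (Nat.primeFactors_mono hd₁P hP₁.ne_zero hp)
  have h1 : (d₁ : ℝ) < D := lt_level_of_pred_of_one_le (by norm_num) hD1 hzD hd₁sq hd₁z hpred
  have h2 : d₂ ≤ Qp := Nat.le_of_dvd hQp (Nat.gcd_dvd_right d Qp)
  have h2' : (d₂ : ℝ) ≤ Qp := by exact_mod_cast h2
  have hd₁0 : (0 : ℝ) ≤ d₁ := Nat.cast_nonneg _
  rw [hsplit]; push_cast
  calc (d₁ : ℝ) * d₂ ≤ d₁ * Qp := mul_le_mul_of_nonneg_left h2' hd₁0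
    _ < D * Qp := mul_lt_mul_of_pos_right h1 (by exact_mod_cast hQp)

end BetaSieve

/-! ### Theorem 9.2 (upper bound) for a sifted sequence -/

namespace SieveSequence

open BetaSieve

variable (A : SieveSequence)

/-- The composite weights give an upper bound for the sifting function:
`S(𝒜, P; x) ≤ ∑_{d ∣ P} λ⁺(d) A_d(x)` for squarefree `P` (Theorem 9.1 with Lemma 9.1).
[cite: Nathanson1996, Thm 9.1 and Lemma 9.1] -/
theorem sifted_le_compSum {D : ℝ} (P₁ : ℕ) (x : ℝ) {P : ℕ} (hP : Squarefree P) :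
    A.sifted x P ≤ ∑ d ∈ P.divisors, compWeight D P₁ d * A.congrSum d x := by
  rw [sum_weights_congrSum A _ hP.ne_zero, sifted_eq_sum_ite]
  refine Finset.sum_le_sum fun n _ => mul_le_mul_of_nonneg_left ?_ (A.a_nonneg n)
  exact compWeight_upper_sieve (hP.squarefree_of_dvd (Nat.gcd_dvd_right n P))

/-- **Theorem 9.2, upper bound** (Nathanson), for Rosser's upper weights with `β = 2` and level `D`
over the sieving range `P₁` (squarefree, prime factors `< z ≤ D`, `D > 1`), extended by a finite
set `Q` of exceptional primes not dividing `P₁` (`P = P₁ ∏_{q ∈ Q} q` squarefree): for a sifted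
sequence with multiplicative density `g` and `X = X(x)`,
`S(𝒜, P; x) ≤ X · G(λ₁⁺) ∏_{q ∈ Q} (1 − g(q)) + ∑_{d ∣ P, d < D ∏Q} |R_d(x)|`,
`G(λ₁⁺) = ∑_{d ∣ P₁} μ(d) χ⁺_D(d) g(d) = BetaSieve.mainSum 1 g 2 D P₁`.
[cite: Nathanson1996, Thm 9.2] -/
theorem sifted_le_compositeSieve {D z : ℝ} {P₁ : ℕ} (hP₁ : Squarefree P₁)
    (hP₁z : ∀ p ∈ P₁.primeFactors, (p : ℝ) < z) (hD1 : 1 < D) (hzD : z ≤ D)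
    (Q : Finset ℕ) (hQ : ∀ q ∈ Q, q.Prime ∧ ¬ q ∣ P₁) (hPsq : Squarefree (P₁ * ∏ q ∈ Q, q)) (x : ℝ) :
    A.sifted x (P₁ * ∏ q ∈ Q, q) ≤
      A.size x * (mainSum 1 A.density 2 D P₁ * ∏ q ∈ Q, (1 - A.density q)) +
        ∑ d ∈ (P₁ * ∏ q ∈ Q, q).divisors.filter (fun d : ℕ => (d : ℝ) < D * ∏ q ∈ Q, (q : ℝ)),
          |A.remainder d x| := by
  classical
  set Qp := ∏ q ∈ Q, q with hQp
  set P := P₁ * Qp with hP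
  have hQp0 : 0 < Qp := Finset.prod_pos fun q hq => (hQ q hq).1.pos
  have hcop : Nat.Coprime P₁ Qp := by
    refine Nat.Coprime.prod_right fun q hq => ?_
    exact (Nat.coprime_comm.mp ((Nat.Prime.coprime_iff_not_dvd (hQ q hq).1).mpr (hQ q hq).2))
  have hcast : (∏ q ∈ Q, (q : ℝ)) = (Qp : ℝ) := by rw [hQp]; push_cast; rfl
  rw [hcast]
  -- Theorem 9.1 with the composite weights
  have h1 := sifted_le_compSum A (D := D) P₁ x hPsq
  -- split `A_d = g(d) X + R_d`
  have hsplit : ∑ d ∈ P.divisors, compWeight D P₁ d * A.congrSum d x =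
      A.size x * ∑ d ∈ P.divisors, compWeight D P₁ d * A.density d +
        ∑ d ∈ P.divisors, compWeight D P₁ d * A.remainder d x := by
    rw [Finset.mul_sum, ← Finset.sum_add_distrib]
    refine Finset.sum_congr rfl fun d _ => ?_
    rw [remainder]; ring
  -- the main term factors (Lemma 9.1)
  have hmain : ∑ d ∈ P.divisors, compWeight D P₁ d * A.density d =
      mainSum 1 A.density 2 D P₁ * ∏ q ∈ Q, (1 - A.density q) :=
    sum_compWeight_mul_eq A.density_mult Q hQ
  -- the remainder is supported on `d < D Qp` (Lemma 9.1) and `|λ⁺| ≤ 1`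
  have hrem : ∑ d ∈ P.divisors, compWeight D P₁ d * A.remainder d x ≤
      ∑ d ∈ P.divisors.filter (fun d : ℕ => (d : ℝ) < D * Qp), |A.remainder d x| := by
    rw [Finset.sum_filter]
    refine Finset.sum_le_sum fun d hd => ?_
    by_cases hne : compWeight D P₁ d = 0
    · rw [hne, zero_mul]; split_ifs <;> positivity
    · have hdP : d ∣ P := Nat.dvd_of_mem_divisors hd
      rw [if_pos (lt_of_compWeight_ne_zero hcop hQp0 hD1 hzD hP₁z hP₁ hdP hne)]
      calc compWeight D P₁ d * A.remainder d x ≤ |compWeight D P₁ d * A.remainder d x| := le_abs_self _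
        _ = |compWeight D P₁ d| * |A.remainder d x| := abs_mul _ _
        _ ≤ 1 * |A.remainder d x| :=
            mul_le_mul_of_nonneg_right (abs_compWeight_le_one D P₁ d) (abs_nonneg _)
        _ = |A.remainder d x| := one_mul _
  calc A.sifted x P ≤ ∑ d ∈ P.divisors, compWeight D P₁ d * A.congrSum d x := h1
    _ = A.size x * ∑ d ∈ P.divisors, compWeight D P₁ d * A.density d +
          ∑ d ∈ P.divisors, compWeight D P₁ d * A.remainder d x := hsplit
    _ ≤ _ := by rw [hmain]; exact add_le_add le_rfl hrem

end SieveSequence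

end Literature.NumberTheory.Sieve
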